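/-
Copyright (c) 2026 the pub-hodgecm-mathlib formalisation cell (harness21).  Prover seat hodgecm-mathlib-LH3-p03 (g4) on line LH3 (closer stub `stub_N9`, N9 «Transf» direct
road), organ J, brick (G′-CANCEL) = LH3-plan (g3) RULINGS #8 (iii) ∕ #9 (ii): the BOX CLAUSES of ★ `ArchChartOrbGBlockDescents` from ★ (M-UNFOLD)'s clauses; 2026-09-02.
-/
import Literature.NumberTheory.Rogawski1990.ArchChartOrbGBlockDescents                     -- ★ p850534∕p850559 (this seat): `exists_hmap_hmapβ_descentConst_eq` (the head with the box clauses as hypotheses)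
import Literature.NumberTheory.Automorphic.ArchInnerFormSemiregularCentralizerBlockCayley   -- ★ p850544 (LH5-p02 (g3)) (M-UNFOLD) Cayley clauses: `gprimeTorus_insert_mem_centralizer`; brings ★ p850446∕p850499 ([4] [5] [6]) and `gprimeTorus_mem_centralizer`
import Mathlib.Algebra.Field.Periodic                                                       -- `Function.Periodic.image_Icc`
import Literature.NumberTheory.Automorphic.ArchRankOneBlockStandardiseCayley                -- ★ p850661 (LH3-p02 (g3)) (B-STD) (iii): `std_eq_hypBlockGL_of_coe_eq_boost` (ED. 2)
import HarnessLib

/-!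
# (G′-CANCEL), ED. 3 as a sibling file: the two BOX CLAUSES `B′_S = e′⁻¹(A × K□)`, `B′♯ = e′⁻¹(B_std × K□)` from ★ (M-UNFOLD)'s per-point clauses, and `K = Kβ` with them discharged
# (Rogawski 1990 §8.2 p. 122, §3.6 p. 31; Folland 1995 §2.2, §2.6)

Topic `NumberTheory/Rogawski1990`; namespace `Literature.NumberTheory.Rogawski1990`.  THEOREMS ONLY (no `def`, no instance, no notation, no axiom, no named fact, no `sorry`);
kernel lane `--kind proof --supports stmt-HodgeConjecture-24833`.  Cell `pub/hodgecm-mathlib`, crux H413 (`stmt-HodgeConjecture-24833`), F0∕P3c line LH3 (closer stub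
`stub_N9`, DIRECT ROAD `F0_P3c_StubN9Direct`, organ J, residual `stub_N9jumpGSide` of skeleton v3.4b), brick **(G′-CANCEL)** (LH3-plan (g3) RULINGS #8 (iii) ∕ #9 (ii); seat
LH3-p03 (g4)).  ★ `exists_hmap_hmapβ_descentConst_eq` (p850534) takes the two chart boxes in block coordinates as HYPOTHESES (`hboxS : {t ∣ (e′ t).2 ∈ K□} = B′_S`,
`hboxβ : {t ∣ (e′ t).1 ∈ B_std, (e′ t).2 ∈ K□} = B′♯`).  This file DISCHARGES them from the per-point clauses of ★ (M-UNFOLD) — [4] `t ∈ T_S ↔ (e t).1` unit diagonal,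
[5] `(e γ_c).1 = diag(e^{i c_{w₀,0}}, e^{i c_{w₀,2}})`, [6] `(e γ_c).2 = γ_{S}(update c w₀ (0, c_{w₀,1}, 0))` (★ p850446∕p850499), the Cayley twin [6β] (★ p850544) and [5β] read
through (B-STD)'s `φ` (`(e′ γ♯_c).1 = hypBlockGL (c w₀ 0) (c w₀ 2)`, the ONE binder the joiner derives from ★ p850544 [5β] + ★ p850488) — with the common `K`-shadow
**`K□ := {k ∣ ↑k ∈ γ_S '' {c ∈ chartBox S ∣ c w₀ 0 = c w₀ 2 = 0}}`** (the `w₀`-degenerate box chart points), and re-exports the head with the box clauses gone: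
**`exists_hmap_hmapβ_descentConst_eq_of_clauses`** (binders: F0P3-p02 (g18)'s ★ p850492 spelling `K e h4 h5 h6 hJ φ e′ he′` + `h6β h5β` + the shared datum + `Ψ hΨ Ψβ hΨβ`).
THE MATHEMATICS (set algebra + `2π`-periodicity of `Circle.exp`): ⊇ is [6]∕[6β]; for ⊆, a torus element `t` with `(e′ t).2 = (e γ_{c₀}).2`, `c₀` degenerate, and
`(e′ t).1 = P·diag(e^{iθ₀}, e^{iθ₂})·P⁻¹` (resp. `= hypBlockGL x θ`) has the same two block components as `γ_c`, `c := update c₀ w₀ (θ₀, c₀ w₀ 1, θ₂)` (resp. `(x, c₀ w₀ 1, θ)`),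
so `t = γ_c` by injectivity of `e′`, and `c` lies in ★ `chartBox` (`w₀ ∉ S`: all three `w₀`-slots of the compact box are `[0, 2π]`; the Cayley box has `x ∈ [0,1]`).
HONEST LABEL: HC_CM is proved only modulo the 7 printed citations (2 remaining named inputs: hLiu418 = `stmt-HodgeConjecture-24832`, h413 = `stmt-HodgeConjecture-24833`) until rung 0
closes; count-neutral bookkeeping under organ J of `stub_N9`.

## References
* [Rogawski1990] J. D. Rogawski, *Automorphic Representations of Unitary Groups in Three Variables*, Ann. of Math. Stud. 123 (1990), §3.6 p. 31 (the Cartan charts), §8.2 p. 122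
  (the compact torus `(θ+ψ, θ₁, θ−ψ)` and the Cayley torus through the same wall point; the normalisation of `dt`), §4.12 Lemma 4.12.1 p. 66.
* [Folland1995] G. B. Folland, *A Course in Abstract Harmonic Analysis* (1995), §2.2, §2.6 Thm. 2.49, (2.52).
* [DeitmarEchterhoff2014] A. Deitmar, S. Echterhoff, *Principles of Harmonic Analysis*, 2nd ed. (2014), Thm. 1.5.3.
* [Shelstad1979] D. Shelstad, *Characters and inner forms of a quasi-split group over ℝ*, Compositio Math. 39 (1979), §4 pp. 22–25.
-/

set_option autoImplicit false

noncomputable section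

open MeasureTheory MeasureTheory.Measure Set Topology NumberField NumberField.InfinitePlace
open Literature.MeasureTheory.Group Literature.NumberTheory.Automorphic Literature.NumberTheory.Automorphic.UnitaryGroup
open scoped MatrixGroups Matrix NNReal ENNReal Real Classical

namespace Literature.NumberTheory.Rogawski1990

/-! ## §1 The BOX CLAUSES from the per-point block clauses of ★ (M-UNFOLD) ([4] [5] [6]; Cayley twins [5β]∕[6β] ★ p850544) -/

section Boxes

variable (L : Type) [Field L] [NumberField L] [IsCMField L] (α : Fin 3 → L)
  (S : Finset {w : InfinitePlace L // IsComplex w}) (w₀ : {w : InfinitePlace L // IsComplex w}) (p : {w : InfinitePlace L // IsComplex w} → Fin 3 → ℝ)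
  {B : Subgroup (GL (Fin 2) ℂ)}
  (K : Subgroup ↥(Subgroup.centralizer ({gprimeTorus L α S p} : Set ↥(arch (↥(maximalRealSubfield L)) L (IsCMField.complexConj L) 3 (Matrix.diagonal α)))))
  (e : ↥(Subgroup.centralizer ({gprimeTorus L α S p} : Set ↥(arch (↥(maximalRealSubfield L)) L (IsCMField.complexConj L) 3 (Matrix.diagonal α)))) ≃ₜ* ↥B × ↥K)
  (hw₀ : w₀ ∉ S)
  -- ★ (M-UNFOLD) p850446∕p850499 clauses [4] [5] [6] (F0P3-p02 (g18)'s binder spelling, ★ p850492)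
  (h4 : ∀ g : ↥(Subgroup.centralizer ({gprimeTorus L α S p} : Set ↥(arch (↥(maximalRealSubfield L)) L (IsCMField.complexConj L) 3 (Matrix.diagonal α)))),
    (g : ↥(arch (↥(maximalRealSubfield L)) L (IsCMField.complexConj L) 3 (Matrix.diagonal α))) ∈ chartTorusG L α S ↔ ((e g).1 : GL (Fin 2) ℂ) ∈ Set.range (circleDiagonal 2))
  (h5 : ∀ c : {w : InfinitePlace L // IsComplex w} → Fin 3 → ℝ,
    ((e ⟨gprimeTorus L α S c, gprimeTorus_mem_centralizer L α S p c⟩).1 : GL (Fin 2) ℂ) = circleDiagonal 2 ![Circle.exp (c w₀ 0), Circle.exp (c w₀ 2)])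
  (h6 : ∀ c : {w : InfinitePlace L // IsComplex w} → Fin 3 → ℝ,
    (((e ⟨gprimeTorus L α S c, gprimeTorus_mem_centralizer L α S p c⟩).2 : ↥(Subgroup.centralizer ({gprimeTorus L α S p} : Set ↥(arch (↥(maximalRealSubfield L)) L (IsCMField.complexConj L) 3 (Matrix.diagonal α))))) :
        ↥(arch (↥(maximalRealSubfield L)) L (IsCMField.complexConj L) 3 (Matrix.diagonal α))) =
      gprimeTorus L α S (Function.update c w₀ ![0, c w₀ 1, 0]))
  {J : Matrix (Fin 2) (Fin 2) ℂ} (hJ : J = (StdForm.antidiagonal 2).over ℂ)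
  (φ : ↥B ≃ₜ* ↥(unitaryGroupOfForm (starRingEnd ℂ) J))
  -- the standardised block equivalence `e′ = (φ × id) ∘ e`, bound abstractly (★ `exists_continuousMulEquiv_prodMap`)
  (e' : ↥(Subgroup.centralizer ({gprimeTorus L α S p} : Set ↥(arch (↥(maximalRealSubfield L)) L (IsCMField.complexConj L) 3 (Matrix.diagonal α)))) ≃ₜ*
    ↥(unitaryGroupOfForm (starRingEnd ℂ) J) × ↥K)
  (he' : ∀ g, e' g = (φ (e g).1, (e g).2))

omit [NumberField L] [IsCMField L] in
/-- Every point of the circle is `e^{iθ}` with `θ ∈ [0, 2π]` (`Circle.exp` is `2π`-periodic and onto). [folklore] -/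
private theorem exists_mem_Icc_circleExp_eq₃ (z : Circle) : ∃ θ ∈ Set.Icc (0 : ℝ) (2 * π), Circle.exp θ = z := by
  have h : z ∈ Circle.exp '' Set.Icc (0 : ℝ) (0 + 2 * π) := by
    rw [Circle.periodic_exp.image_Icc Real.two_pi_pos 0]
    exact ⟨Complex.arg (z : ℂ), Circle.exp_arg z⟩
  obtain ⟨θ, hθ, hz⟩ := h
  exact ⟨θ, by simpa only [zero_add] using hθ, hz⟩

omit [NumberField L] [IsCMField L] in
/-- Membership in ★ `chartBox` coordinate by coordinate (definitional unfolding). [cite: Folland1995, §2.2] -/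
private theorem mem_chartBox_iff₃ (S' : Finset {w : InfinitePlace L // IsComplex w}) (c : {w : InfinitePlace L // IsComplex w} → Fin 3 → ℝ) :
    c ∈ chartBox L S' ↔ ∀ w i, c w i ∈ Set.Icc (0 : ℝ) (if w ∈ S' ∧ i = 0 then 1 else 2 * Real.pi) := by
  simp only [chartBox, Set.mem_univ_pi]

set_option maxHeartbeats 800000 in
include hw₀ h4 h5 h6 he' in
/-- **THE COMPACT-CHART BOX CLAUSE `hboxS` FROM [4] [5] [6]** (`w₀ ∉ S`): a chart-torus element `t ∈ T_S` lies in the box image `B′_S` iff the `K`-component of `e′ t` is a chart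
point `gprimeTorus α S c₀` with `c₀` in the box and `w₀`-DEGENERATE (`c₀ w₀ 0 = c₀ w₀ 2 = 0`).  (⊇: [6].  ⊆: the `B`-component of `t` is `diag(e^{iθ₀}, e^{iθ₂})`, `θ_i ∈ [0,2π]`
([4] + periodicity); `c := update c₀ w₀ (θ₀, c₀ w₀ 1, θ₂)` has the same two components ([5] [6]), so `t = gprimeTorus α S c` by injectivity of `e′`.)
[cite: Rogawski1990, §8.2 p. 122; §3.6 p. 31] [cite: Folland1995, §2.2] -/
theorem setOf_snd_mem_eq_chartBoxImgG :
    {t : ↥(chartTorusG L α S) |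
        (e' ⟨(t : ↥(arch (↥(maximalRealSubfield L)) L (IsCMField.complexConj L) 3 (Matrix.diagonal α))), chartTorusG_le_centralizer L α S p t.2⟩).2 ∈
          {k : ↥K | ((k : ↥(Subgroup.centralizer ({gprimeTorus L α S p} : Set ↥(arch (↥(maximalRealSubfield L)) L (IsCMField.complexConj L) 3 (Matrix.diagonal α))))) :
              ↥(arch (↥(maximalRealSubfield L)) L (IsCMField.complexConj L) 3 (Matrix.diagonal α))) ∈
            gprimeTorus L α S '' {c | c ∈ chartBox L S ∧ c w₀ 0 = 0 ∧ c w₀ 2 = 0}}} = chartBoxImgG L α S := by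
  have hsnd : ∀ g, (e' g).2 = (e g).2 := fun g => by rw [he']
  ext t
  simp only [Set.mem_setOf_eq, Set.mem_image]
  constructor
  · rintro ⟨c₀, ⟨hc₀, h0, h2⟩, hc₀t⟩
    -- the `B`-component of `t`
    obtain ⟨u, hu⟩ := (h4 ⟨(t : ↥(arch (↥(maximalRealSubfield L)) L (IsCMField.complexConj L) 3 (Matrix.diagonal α))), chartTorusG_le_centralizer L α S p t.2⟩).1 t.2
    obtain ⟨θ₀, hθ₀, hu₀⟩ := exists_mem_Icc_circleExp_eq₃ (u 0)
    obtain ⟨θ₂, hθ₂, hu₂⟩ := exists_mem_Icc_circleExp_eq₃ (u 1)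
    set c : {w : InfinitePlace L // IsComplex w} → Fin 3 → ℝ := Function.update c₀ w₀ ![θ₀, c₀ w₀ 1, θ₂] with hc_def
    have hc0 : c w₀ 0 = θ₀ := by rw [hc_def, Function.update_self]; rfl
    have hc1 : c w₀ 1 = c₀ w₀ 1 := by rw [hc_def, Function.update_self]; rfl
    have hc2 : c w₀ 2 = θ₂ := by rw [hc_def, Function.update_self]; rfl
    have hcw : ∀ w', w' ≠ w₀ → c w' = c₀ w' := fun w' hw' => by rw [hc_def, Function.update_of_ne hw']
    have hupd : Function.update c w₀ ![0, c w₀ 1, 0] = c₀ := by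
      rw [hc1, hc_def, Function.update_idem, Function.update_eq_self_iff]
      funext i
      fin_cases i
      · exact h0.symm
      · rfl
      · exact h2.symm
    -- `e (γ c) = e t`
    have hmem : gprimeTorus L α S c ∈ Subgroup.centralizer ({gprimeTorus L α S p} : Set ↥(arch (↥(maximalRealSubfield L)) L (IsCMField.complexConj L) 3 (Matrix.diagonal α))) :=
      gprimeTorus_mem_centralizer L α S p c
    have hEq : e ⟨gprimeTorus L α S c, hmem⟩ =
        e ⟨(t : ↥(arch (↥(maximalRealSubfield L)) L (IsCMField.complexConj L) 3 (Matrix.diagonal α))), chartTorusG_le_centralizer L α S p t.2⟩ := by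
      refine Prod.ext (Subtype.ext ?_) (Subtype.ext (Subtype.ext ?_))
      · rw [h5 c, ← hu, hc0, hc2, hu₀, hu₂]
        congr 1
        funext i
        fin_cases i <;> rfl
      · rw [h6 c, hupd, hc₀t, hsnd]
    have ht : gprimeTorus L α S c = (t : ↥(arch (↥(maximalRealSubfield L)) L (IsCMField.complexConj L) 3 (Matrix.diagonal α))) :=
      congrArg Subtype.val (e.injective hEq)
    refine ⟨c, ?_, Subtype.ext ht⟩
    -- `c` lies in the box
    rw [mem_chartBox_iff₃] at hc₀ ⊢
    intro w' i
    by_cases hw' : w' = w₀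
    · subst hw'
      have hcond : ∀ j : Fin 3, ¬ (w' ∈ S ∧ j = 0) := fun j h => hw₀ h.1
      have h1 := hc₀ w' 1
      rw [if_neg (hcond 1)] at h1
      rw [if_neg (hcond i), hc_def, Function.update_self]
      fin_cases i
      · exact hθ₀
      · exact h1
      · exact hθ₂
    · rw [hcw w' hw']
      exact hc₀ w' i
  · rintro ⟨c, hc, rfl⟩
    refine ⟨Function.update c w₀ ![0, c w₀ 1, 0], ⟨?_, by simp, by simp⟩, ?_⟩
    · rw [mem_chartBox_iff₃] at hc ⊢
      intro w' i
      by_cases hw' : w' = w₀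
      · subst hw'
        have hcond : ∀ j : Fin 3, ¬ (w' ∈ S ∧ j = 0) := fun j h => hw₀ h.1
        have h1 := hc w' 1
        rw [if_neg (hcond 1)] at h1
        rw [if_neg (hcond i), Function.update_self]
        fin_cases i
        · exact ⟨le_rfl, Real.two_pi_pos.le⟩
        · exact h1
        · exact ⟨le_rfl, Real.two_pi_pos.le⟩
      · rw [Function.update_of_ne hw']
        exact hc w' i
    · rw [hsnd]
      exact (h6 c).symm

variable (hTβ : chartTorusG L α (insert w₀ S) ≤ Subgroup.centralizer ({gprimeTorus L α S p} : Set ↥(arch (↥(maximalRealSubfield L)) L (IsCMField.complexConj L) 3 (Matrix.diagonal α))))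
  (hsp : w₀ ∈ splitChartPlaces L α) (hp : p w₀ 0 = p w₀ 2)
  -- ★ p850544 clause [6β]
  (h6β : ∀ c : {w : InfinitePlace L // IsComplex w} → Fin 3 → ℝ,
    ((((e ⟨gprimeTorus L α (insert w₀ S) c, gprimeTorus_insert_mem_centralizer L α hw₀ hsp hp c⟩).2 : ↥K) :
        ↥(Subgroup.centralizer ({gprimeTorus L α S p} : Set ↥(arch (↥(maximalRealSubfield L)) L (IsCMField.complexConj L) 3 (Matrix.diagonal α))))) :
          ↥(arch (↥(maximalRealSubfield L)) L (IsCMField.complexConj L) 3 (Matrix.diagonal α))) =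
      gprimeTorus L α S (Function.update c w₀ ![0, c w₀ 1, 0]))
  -- ★ p850544 clause [5β] pushed through (B-STD) (iii): the `U(J)`-component of a Cayley-chart point is the split-torus element `hypBlockGL x θ`
  (h5β : ∀ c : {w : InfinitePlace L // IsComplex w} → Fin 3 → ℝ,
    (e' ⟨gprimeTorus L α (insert w₀ S) c, gprimeTorus_insert_mem_centralizer L α hw₀ hsp hp c⟩).1 =
      ⟨hypBlockGL (c w₀ 0) (c w₀ 2), hypBlockGL_mem_of_eq_over hJ (c w₀ 0) (c w₀ 2)⟩)

set_option maxHeartbeats 800000 in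
include he' h6β h5β in
/-- **THE CAYLEY-CHART BOX CLAUSE `hboxβ` FROM [5β] [6β]** (`w₀ ∉ S`): `t ∈ T♯ = chartTorusG α (insert w₀ S)` lies in `B′♯` iff the `U(J)`-component of `e′ t` is a box
split-torus element `hypBlockGL x θ`, `(x, θ) ∈ [0,1] × [0,2π]` (the set `B_std` of LH4-p03's `hlink`) and its `K`-component is a `w₀`-degenerate box chart point — the SAME
`K`-shadow as on the compact chart. [cite: Rogawski1990, §8.2 p. 122; §3.6 p. 31] [cite: Folland1995, §2.2] -/
theorem setOf_fst_snd_mem_eq_chartBoxImgG_insert :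
    {t : ↥(chartTorusG L α (insert w₀ S)) |
        ((e' ⟨(t : ↥(arch (↥(maximalRealSubfield L)) L (IsCMField.complexConj L) 3 (Matrix.diagonal α))), hTβ t.2⟩).1 : ↥(unitaryGroupOfForm (starRingEnd ℂ) J)) ∈
            Subtype.val '' ((fun q : ℝ × ℝ => (⟨⟨hypBlockGL q.1 q.2, hypBlockGL_mem_of_eq_over hJ q.1 q.2⟩, hypBlockGL_mem_torusU hJ q.1 q.2⟩ : ↥(torusU (starRingEnd ℂ) J))) ''
              (Set.Icc (0 : ℝ) 1 ×ˢ Set.Icc (0 : ℝ) (2 * π))) ∧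
          (e' ⟨(t : ↥(arch (↥(maximalRealSubfield L)) L (IsCMField.complexConj L) 3 (Matrix.diagonal α))), hTβ t.2⟩).2 ∈
            {k : ↥K | ((k : ↥(Subgroup.centralizer ({gprimeTorus L α S p} : Set ↥(arch (↥(maximalRealSubfield L)) L (IsCMField.complexConj L) 3 (Matrix.diagonal α))))) :
                ↥(arch (↥(maximalRealSubfield L)) L (IsCMField.complexConj L) 3 (Matrix.diagonal α))) ∈
              gprimeTorus L α S '' {c | c ∈ chartBox L S ∧ c w₀ 0 = 0 ∧ c w₀ 2 = 0}}} = chartBoxImgG L α (insert w₀ S) := by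
  have hsnd : ∀ g, (e' g).2 = (e g).2 := fun g => by rw [he']
  have hins : ∀ w', w' ≠ w₀ → ∀ j : Fin 3, (if w' ∈ insert w₀ S ∧ j = 0 then (1 : ℝ) else 2 * Real.pi) = (if w' ∈ S ∧ j = 0 then (1 : ℝ) else 2 * Real.pi) :=
    fun w' hw' j => by simp only [Finset.mem_insert, hw', false_or]
  ext t
  simp only [Set.mem_setOf_eq, Set.mem_image, Set.mem_prod]
  constructor
  · rintro ⟨⟨b, ⟨q, ⟨hq1, hq2⟩, rfl⟩, hb⟩, c₀, ⟨hc₀, h0, h2⟩, hc₀t⟩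
    set c : {w : InfinitePlace L // IsComplex w} → Fin 3 → ℝ := Function.update c₀ w₀ ![q.1, c₀ w₀ 1, q.2] with hc_def
    have hc0 : c w₀ 0 = q.1 := by rw [hc_def, Function.update_self]; rfl
    have hc1 : c w₀ 1 = c₀ w₀ 1 := by rw [hc_def, Function.update_self]; rfl
    have hc2 : c w₀ 2 = q.2 := by rw [hc_def, Function.update_self]; rfl
    have hcw : ∀ w', w' ≠ w₀ → c w' = c₀ w' := fun w' hw' => by rw [hc_def, Function.update_of_ne hw']
    have hupd : Function.update c w₀ ![0, c w₀ 1, 0] = c₀ := by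
      rw [hc1, hc_def, Function.update_idem, Function.update_eq_self_iff]
      funext i
      fin_cases i
      · exact h0.symm
      · rfl
      · exact h2.symm
    have hEq : e' ⟨gprimeTorus L α (insert w₀ S) c, gprimeTorus_insert_mem_centralizer L α hw₀ hsp hp c⟩ =
        e' ⟨(t : ↥(arch (↥(maximalRealSubfield L)) L (IsCMField.complexConj L) 3 (Matrix.diagonal α))), hTβ t.2⟩ := by
      refine Prod.ext ?_ (Subtype.ext (Subtype.ext ?_))
      · rw [h5β c, hc0, hc2]
        exact hb
      · rw [hsnd, h6β c, hupd, hc₀t]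
    have ht : gprimeTorus L α (insert w₀ S) c = (t : ↥(arch (↥(maximalRealSubfield L)) L (IsCMField.complexConj L) 3 (Matrix.diagonal α))) :=
      congrArg Subtype.val (e'.injective hEq)
    refine ⟨c, ?_, Subtype.ext ht⟩
    rw [mem_chartBox_iff₃] at hc₀ ⊢
    intro w' i
    by_cases hw' : w' = w₀
    · subst hw'
      have h1 := hc₀ w' 1
      rw [if_neg (fun h => hw₀ h.1)] at h1
      rw [hc_def, Function.update_self]
      fin_cases i
      · rw [if_pos ⟨Finset.mem_insert_self w' S, rfl⟩]; exact hq1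
      · rw [if_neg (fun h => absurd h.2 (by decide))]; exact h1
      · rw [if_neg (fun h => absurd h.2 (by decide))]; exact hq2
    · rw [hcw w' hw', hins w' hw' i]
      exact hc₀ w' i
  · rintro ⟨c, hc, rfl⟩
    rw [mem_chartBox_iff₃] at hc
    refine ⟨⟨(⟨⟨hypBlockGL (c w₀ 0) (c w₀ 2), hypBlockGL_mem_of_eq_over hJ (c w₀ 0) (c w₀ 2)⟩, hypBlockGL_mem_torusU hJ (c w₀ 0) (c w₀ 2)⟩ : ↥(torusU (starRingEnd ℂ) J)),
      ⟨(c w₀ 0, c w₀ 2), ⟨?_, ?_⟩, rfl⟩, ?_⟩, Function.update c w₀ ![0, c w₀ 1, 0], ⟨?_, by simp, by simp⟩, ?_⟩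
    · have h0 := hc w₀ 0
      rw [if_pos ⟨Finset.mem_insert_self w₀ S, rfl⟩] at h0
      exact h0
    · have h2 := hc w₀ 2
      rw [if_neg (fun h => absurd h.2 (by decide))] at h2
      exact h2
    · exact (h5β c).symm
    · rw [mem_chartBox_iff₃]
      intro w' i
      by_cases hw' : w' = w₀
      · subst hw'
        have hcond : ∀ j : Fin 3, ¬ (w' ∈ S ∧ j = 0) := fun j h => hw₀ h.1
        have h1 := hc w' 1
        rw [if_neg (fun h => absurd h.2 (by decide))] at h1
        rw [if_neg (hcond i), Function.update_self]
        fin_cases i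
        · exact ⟨le_rfl, Real.two_pi_pos.le⟩
        · exact h1
        · exact ⟨le_rfl, Real.two_pi_pos.le⟩
      · rw [Function.update_of_ne hw', ← hins w' hw' i]
        exact hc w' i
    · rw [hsnd]
      exact (h6β c).symm

end Boxes

/-! ## §2 The head with the box clauses discharged -/

section CancelClauses

variable (L : Type) [Field L] [NumberField L] [IsCMField L] (α : Fin 3 → L)
  [MeasurableSpace ↥(arch (↥(maximalRealSubfield L)) L (IsCMField.complexConj L) 3 (Matrix.diagonal α))]
  [BorelSpace ↥(arch (↥(maximalRealSubfield L)) L (IsCMField.complexConj L) 3 (Matrix.diagonal α))]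
  (S : Finset {w : InfinitePlace L // IsComplex w}) (w₀ : {w : InfinitePlace L // IsComplex w}) (p : {w : InfinitePlace L // IsComplex w} → Fin 3 → ℝ)
  (hw₀ : w₀ ∉ S) (hsp : w₀ ∈ splitChartPlaces L α) (hp : p w₀ 0 = p w₀ 2)
  (hT : chartTorusG L α S ≤ Subgroup.centralizer ({gprimeTorus L α S p} : Set ↥(arch (↥(maximalRealSubfield L)) L (IsCMField.complexConj L) 3 (Matrix.diagonal α))))
  (hTβ : chartTorusG L α (insert w₀ S) ≤ Subgroup.centralizer ({gprimeTorus L α S p} : Set ↥(arch (↥(maximalRealSubfield L)) L (IsCMField.complexConj L) 3 (Matrix.diagonal α))))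
  [MeasurableSpace (↥(Subgroup.centralizer ({gprimeTorus L α S p} : Set ↥(arch (↥(maximalRealSubfield L)) L (IsCMField.complexConj L) 3 (Matrix.diagonal α)))) ⧸
    (chartTorusG L α S).subgroupOf (Subgroup.centralizer ({gprimeTorus L α S p} : Set ↥(arch (↥(maximalRealSubfield L)) L (IsCMField.complexConj L) 3 (Matrix.diagonal α)))))]
  [BorelSpace (↥(Subgroup.centralizer ({gprimeTorus L α S p} : Set ↥(arch (↥(maximalRealSubfield L)) L (IsCMField.complexConj L) 3 (Matrix.diagonal α)))) ⧸
    (chartTorusG L α S).subgroupOf (Subgroup.centralizer ({gprimeTorus L α S p} : Set ↥(arch (↥(maximalRealSubfield L)) L (IsCMField.complexConj L) 3 (Matrix.diagonal α)))))]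
  [MeasurableSpace (↥(Subgroup.centralizer ({gprimeTorus L α S p} : Set ↥(arch (↥(maximalRealSubfield L)) L (IsCMField.complexConj L) 3 (Matrix.diagonal α)))) ⧸
    (chartTorusG L α (insert w₀ S)).subgroupOf (Subgroup.centralizer ({gprimeTorus L α S p} : Set ↥(arch (↥(maximalRealSubfield L)) L (IsCMField.complexConj L) 3 (Matrix.diagonal α)))))]
  [BorelSpace (↥(Subgroup.centralizer ({gprimeTorus L α S p} : Set ↥(arch (↥(maximalRealSubfield L)) L (IsCMField.complexConj L) 3 (Matrix.diagonal α)))) ⧸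
    (chartTorusG L α (insert w₀ S)).subgroupOf (Subgroup.centralizer ({gprimeTorus L α S p} : Set ↥(arch (↥(maximalRealSubfield L)) L (IsCMField.complexConj L) 3 (Matrix.diagonal α)))))]
  [LocallyCompactSpace ↥(Subgroup.centralizer ({gprimeTorus L α S p} : Set ↥(arch (↥(maximalRealSubfield L)) L (IsCMField.complexConj L) 3 (Matrix.diagonal α))))]
  (νM : Measure ↥(Subgroup.centralizer ({gprimeTorus L α S p} : Set ↥(arch (↥(maximalRealSubfield L)) L (IsCMField.complexConj L) 3 (Matrix.diagonal α))))) [νM.IsHaarMeasure] [νM.IsMulRightInvariant]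
  -- the standard block `U(J)` and the SHARED rank-one datum (cert v34b: `μ₀`, `μ₀′`, `hlink`; no torus σ-algebra binders, ruling «= (i)» 2026-09-02T08:38Z)
  {J : Matrix (Fin 2) (Fin 2) ℂ} (hJ : J = (StdForm.antidiagonal 2).over ℂ)
  [MeasurableSpace ↥(unitaryGroupOfForm (starRingEnd ℂ) J)] [BorelSpace ↥(unitaryGroupOfForm (starRingEnd ℂ) J)]
  [LocallyCompactSpace ↥(unitaryGroupOfForm (starRingEnd ℂ) J)] [SecondCountableTopology ↥(unitaryGroupOfForm (starRingEnd ℂ) J)]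
  [MeasurableSpace (↥(unitaryGroupOfForm (starRingEnd ℂ) J) ⧸ torusU (starRingEnd ℂ) J)] [BorelSpace (↥(unitaryGroupOfForm (starRingEnd ℂ) J) ⧸ torusU (starRingEnd ℂ) J)]
  (μ₀ : Measure ↥(unitaryGroupOfForm (starRingEnd ℂ) J)) [μ₀.IsHaarMeasure] [μ₀.IsMulRightInvariant]
  (μ₀' : Measure (↥(unitaryGroupOfForm (starRingEnd ℂ) J) ⧸ torusU (starRingEnd ℂ) J))
  (hlink : ∀ (ρ : Measure ↥(torusU (starRingEnd ℂ) J)) [ρ.IsHaarMeasure] [ρ.IsInvInvariant],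
    μ₀' = ρ ((fun q : ℝ × ℝ => (⟨⟨hypBlockGL q.1 q.2, hypBlockGL_mem_of_eq_over hJ q.1 q.2⟩, hypBlockGL_mem_torusU hJ q.1 q.2⟩ : ↥(torusU (starRingEnd ℂ) J))) ''
        (Set.Icc (0 : ℝ) 1 ×ˢ Set.Icc (0 : ℝ) (2 * π))) •
      quotientMeasure (torusU (starRingEnd ℂ) J) ρ (LineRing.isClosed_torusU_two (starRingEnd ℂ) J) μ₀)
  (σ : Measure ↥(torusU (starRingEnd ℂ) J)) [σ.IsHaarMeasure] [σ.IsInvInvariant]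
  (hσ0 : σ ((fun q : ℝ × ℝ => (⟨⟨hypBlockGL q.1 q.2, hypBlockGL_mem_of_eq_over hJ q.1 q.2⟩, hypBlockGL_mem_torusU hJ q.1 q.2⟩ : ↥(torusU (starRingEnd ℂ) J))) ''
        (Set.Icc (0 : ℝ) 1 ×ˢ Set.Icc (0 : ℝ) (2 * π))) ≠ 0)
  (hσt : σ ((fun q : ℝ × ℝ => (⟨⟨hypBlockGL q.1 q.2, hypBlockGL_mem_of_eq_over hJ q.1 q.2⟩, hypBlockGL_mem_torusU hJ q.1 q.2⟩ : ↥(torusU (starRingEnd ℂ) J))) ''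
        (Set.Icc (0 : ℝ) 1 ×ˢ Set.Icc (0 : ℝ) (2 * π))) ≠ ⊤)
  (A : Subgroup ↥(unitaryGroupOfForm (starRingEnd ℂ) J)) [CompactSpace ↥A] (hAcomm : ∀ a b : ↥A, a * b = b * a)
  [MeasurableSpace (↥(unitaryGroupOfForm (starRingEnd ℂ) J) ⧸ A)] [BorelSpace (↥(unitaryGroupOfForm (starRingEnd ℂ) J) ⧸ A)]
  -- ★ (M-UNFOLD) `e : Z(s) ≃ₜ* B × K` with clauses [1] [3] [4] [5] [6] (★ p850446∕p850499) and [6β] (★ p850544), in F0P3-p02 (g18)'s ★ p850492 spelling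
  {B : Subgroup (GL (Fin 2) ℂ)}
  (K : Subgroup ↥(Subgroup.centralizer ({gprimeTorus L α S p} : Set ↥(arch (↥(maximalRealSubfield L)) L (IsCMField.complexConj L) 3 (Matrix.diagonal α)))))
  (hKc : IsClosed (K : Set ↥(Subgroup.centralizer ({gprimeTorus L α S p} : Set ↥(arch (↥(maximalRealSubfield L)) L (IsCMField.complexConj L) 3 (Matrix.diagonal α))))))
  (hKcomm : ∀ k₁, k₁ ∈ K → ∀ k₂, k₂ ∈ K → k₁ * k₂ = k₂ * k₁)
  (e : ↥(Subgroup.centralizer ({gprimeTorus L α S p} : Set ↥(arch (↥(maximalRealSubfield L)) L (IsCMField.complexConj L) 3 (Matrix.diagonal α)))) ≃ₜ* ↥B × ↥K)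
  (h4 : ∀ g : ↥(Subgroup.centralizer ({gprimeTorus L α S p} : Set ↥(arch (↥(maximalRealSubfield L)) L (IsCMField.complexConj L) 3 (Matrix.diagonal α)))),
    (g : ↥(arch (↥(maximalRealSubfield L)) L (IsCMField.complexConj L) 3 (Matrix.diagonal α))) ∈ chartTorusG L α S ↔ ((e g).1 : GL (Fin 2) ℂ) ∈ Set.range (circleDiagonal 2))
  (h5 : ∀ c : {w : InfinitePlace L // IsComplex w} → Fin 3 → ℝ,
    ((e ⟨gprimeTorus L α S c, gprimeTorus_mem_centralizer L α S p c⟩).1 : GL (Fin 2) ℂ) = circleDiagonal 2 ![Circle.exp (c w₀ 0), Circle.exp (c w₀ 2)])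
  (h6 : ∀ c : {w : InfinitePlace L // IsComplex w} → Fin 3 → ℝ,
    (((e ⟨gprimeTorus L α S c, gprimeTorus_mem_centralizer L α S p c⟩).2 : ↥(Subgroup.centralizer ({gprimeTorus L α S p} : Set ↥(arch (↥(maximalRealSubfield L)) L (IsCMField.complexConj L) 3 (Matrix.diagonal α))))) :
        ↥(arch (↥(maximalRealSubfield L)) L (IsCMField.complexConj L) 3 (Matrix.diagonal α))) =
      gprimeTorus L α S (Function.update c w₀ ![0, c w₀ 1, 0]))
  (h6β : ∀ c : {w : InfinitePlace L // IsComplex w} → Fin 3 → ℝ,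
    ((((e ⟨gprimeTorus L α (insert w₀ S) c, gprimeTorus_insert_mem_centralizer L α hw₀ hsp hp c⟩).2 : ↥K) :
        ↥(Subgroup.centralizer ({gprimeTorus L α S p} : Set ↥(arch (↥(maximalRealSubfield L)) L (IsCMField.complexConj L) 3 (Matrix.diagonal α))))) :
          ↥(arch (↥(maximalRealSubfield L)) L (IsCMField.complexConj L) 3 (Matrix.diagonal α))) =
      gprimeTorus L α S (Function.update c w₀ ![0, c w₀ 1, 0]))
  -- (B-STD) `φ` and the standardised `e′ = (φ × id) ∘ e` (★ p850488 `exists_continuousMulEquiv_prod_std`), with [5β] through `φ` ((B-STD) (iii))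
  (φ : ↥B ≃ₜ* ↥(unitaryGroupOfForm (starRingEnd ℂ) J))
  (e' : ↥(Subgroup.centralizer ({gprimeTorus L α S p} : Set ↥(arch (↥(maximalRealSubfield L)) L (IsCMField.complexConj L) 3 (Matrix.diagonal α)))) ≃ₜ*
    ↥(unitaryGroupOfForm (starRingEnd ℂ) J) × ↥K)
  (he' : ∀ g, e' g = (φ (e g).1, (e g).2))
  (h5β : ∀ c : {w : InfinitePlace L // IsComplex w} → Fin 3 → ℝ,
    (e' ⟨gprimeTorus L α (insert w₀ S) c, gprimeTorus_insert_mem_centralizer L α hw₀ hsp hp c⟩).1 =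
      ⟨hypBlockGL (c w₀ 0) (c w₀ 2), hypBlockGL_mem_of_eq_over hJ (c w₀ 0) (c w₀ 2)⟩)
  -- the membership clauses for `e′` and the quotient homeomorphisms (★ p850477 §1 at `e′`)
  (hTA : ∀ g : ↥(Subgroup.centralizer ({gprimeTorus L α S p} : Set ↥(arch (↥(maximalRealSubfield L)) L (IsCMField.complexConj L) 3 (Matrix.diagonal α)))),
    g ∈ (chartTorusG L α S).subgroupOf (Subgroup.centralizer ({gprimeTorus L α S p} : Set ↥(arch (↥(maximalRealSubfield L)) L (IsCMField.complexConj L) 3 (Matrix.diagonal α)))) ↔ (e' g).1 ∈ A)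
  (hTAβ : ∀ g : ↥(Subgroup.centralizer ({gprimeTorus L α S p} : Set ↥(arch (↥(maximalRealSubfield L)) L (IsCMField.complexConj L) 3 (Matrix.diagonal α)))),
    g ∈ (chartTorusG L α (insert w₀ S)).subgroupOf (Subgroup.centralizer ({gprimeTorus L α S p} : Set ↥(arch (↥(maximalRealSubfield L)) L (IsCMField.complexConj L) 3 (Matrix.diagonal α)))) ↔
      (e' g).1 ∈ torusU (starRingEnd ℂ) J)
  (Ψ : (↥(Subgroup.centralizer ({gprimeTorus L α S p} : Set ↥(arch (↥(maximalRealSubfield L)) L (IsCMField.complexConj L) 3 (Matrix.diagonal α)))) ⧸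
      (chartTorusG L α S).subgroupOf (Subgroup.centralizer ({gprimeTorus L α S p} : Set ↥(arch (↥(maximalRealSubfield L)) L (IsCMField.complexConj L) 3 (Matrix.diagonal α))))) ≃ₜ
      ↥(unitaryGroupOfForm (starRingEnd ℂ) J) ⧸ A)
  (hΨ : ∀ b : ↥(unitaryGroupOfForm (starRingEnd ℂ) J), Ψ.symm (QuotientGroup.mk b) = QuotientGroup.mk (e'.symm (b, 1)))
  (Ψβ : (↥(Subgroup.centralizer ({gprimeTorus L α S p} : Set ↥(arch (↥(maximalRealSubfield L)) L (IsCMField.complexConj L) 3 (Matrix.diagonal α)))) ⧸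
      (chartTorusG L α (insert w₀ S)).subgroupOf (Subgroup.centralizer ({gprimeTorus L α S p} : Set ↥(arch (↥(maximalRealSubfield L)) L (IsCMField.complexConj L) 3 (Matrix.diagonal α))))) ≃ₜ
      ↥(unitaryGroupOfForm (starRingEnd ℂ) J) ⧸ torusU (starRingEnd ℂ) J)
  (hΨβ : ∀ b : ↥(unitaryGroupOfForm (starRingEnd ℂ) J), Ψβ.symm (QuotientGroup.mk b) = QuotientGroup.mk (e'.symm (b, 1)))

set_option maxHeartbeats 800000 in
include hlink hσ0 hσt hAcomm hKc hKcomm h4 h5 h6 h6β he' h5β hTA hTAβ hΨ hΨβ in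
/-- **(G′-CANCEL) FROM THE CLAUSES — `K = Kβ` with the box clauses DISCHARGED.**  At the compact-wall point `s = gprimeTorus α S p` (`w₀ ∉ S` a split-chart place,
`p w₀ 0 = p w₀ 2`): from ★ (M-UNFOLD)'s block splitting `e : Z(s) ≃ₜ* B × K` with its clauses [1] [3] [4] [5] [6] and the Cayley twin [6β], (B-STD)'s `φ : B ≃ₜ* U(J)` and the
standardised `e′` (`e′ g = (φ (e g).1, (e g).2)`) with [5β] read through `φ` (`(e′ γ♯_c).1 = hypBlockGL (c w₀ 0) (c w₀ 2)`), the membership clauses of the two chart tori and the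
two quotient homeomorphisms, ANY Haar `νM` on `Z(s)`, the SHARED `μ₀`, `μ₀′` (`hlink`) and one box-positive Haar `σ` on the split torus (★ `measure_image_hypBlockGL_box_pos_lt_top`):
there are `κ, κβ > 0` with ★ p850417's `hmap` (`νB := μ₀`), ★ p850444's `hmapβ` (`μ := μ₀′`) and **`dt′_S(B′_S) · κ = dt′♯(B′♯) · κβ`**.  (= `exists_hmap_hmapβ_descentConst_eq` ∘
`setOf_snd_mem_eq_chartBoxImgG` ∘ `setOf_fst_snd_mem_eq_chartBoxImgG_insert`.) [cite: Rogawski1990, §8.2 p. 122; §4.12 Lemma 4.12.1 p. 66] [cite: Folland1995, §2.6 Thm. 2.49, (2.52)]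
[cite: DeitmarEchterhoff2014, Thm. 1.5.3] [cite: Shelstad1979, §4 pp. 22–25] -/
theorem exists_hmap_hmapβ_descentConst_eq_of_clauses :
    ∃ κ κβ : ℝ≥0, κ ≠ 0 ∧ κβ ≠ 0 ∧
      (haveI := isHaarMeasure_chartHaarG L α S
       haveI := isInvInvariant_chartHaarG L α S
       haveI := isHaarMeasure_map_subgroupOfEquivOfLe_symm hT (chartHaarG L α S)
       haveI := isInvInvariant_map_subgroupOfEquivOfLe_symm hT (chartHaarG L α S)
      Measure.map Ψ (quotientMeasure ((chartTorusG L α S).subgroupOf (Subgroup.centralizer ({gprimeTorus L α S p} : Set ↥(arch (↥(maximalRealSubfield L)) L (IsCMField.complexConj L) 3 (Matrix.diagonal α)))))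
          (Measure.map (Subgroup.subgroupOfEquivOfLe hT).symm (chartHaarG L α S))
          (isClosed_subgroupOf_of_isClosed _ _ (isClosed_chartTorusG L α S)) νM)) = κ • Measure.map (QuotientGroup.mk : ↥(unitaryGroupOfForm (starRingEnd ℂ) J) → _) μ₀ ∧
      (haveI := isHaarMeasure_chartHaarG L α (insert w₀ S)
       haveI := isInvInvariant_chartHaarG L α (insert w₀ S)
       haveI := isHaarMeasure_map_subgroupOfEquivOfLe_symm hTβ (chartHaarG L α (insert w₀ S))
       haveI := isInvInvariant_map_subgroupOfEquivOfLe_symm hTβ (chartHaarG L α (insert w₀ S))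
      Measure.map Ψβ (quotientMeasure ((chartTorusG L α (insert w₀ S)).subgroupOf (Subgroup.centralizer ({gprimeTorus L α S p} : Set ↥(arch (↥(maximalRealSubfield L)) L (IsCMField.complexConj L) 3 (Matrix.diagonal α)))))
          (Measure.map (Subgroup.subgroupOfEquivOfLe hTβ).symm (chartHaarG L α (insert w₀ S)))
          (isClosed_subgroupOf_of_isClosed _ _ (isClosed_chartTorusG L α (insert w₀ S))) νM)) = κβ • μ₀' ∧
      (haveI := isHaarMeasure_chartHaarG L α S; (chartHaarG L α S (chartBoxImgG L α S)).toReal) * (κ : ℝ) =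
        (haveI := isHaarMeasure_chartHaarG L α (insert w₀ S); (chartHaarG L α (insert w₀ S) (chartBoxImgG L α (insert w₀ S))).toReal) * (κβ : ℝ) := by
  have hboxS := setOf_snd_mem_eq_chartBoxImgG L α S w₀ p K e hw₀ h4 h5 h6 φ e' he'
  have hboxβ := setOf_fst_snd_mem_eq_chartBoxImgG_insert L α S w₀ p K e hw₀ hJ φ e' he' hTβ hsp hp h6β h5β
  exact exists_hmap_hmapβ_descentConst_eq L α S w₀ (gprimeTorus L α S p) hT hTβ νM hJ μ₀ μ₀' hlink σ hσ0 hσt A hAcomm K hKc hKcomm e' hTA hTAβ Ψ hΨ Ψβ hΨβ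
    _ hboxS hboxβ

end CancelClauses


/-! ## (ED. 2) The `h5β` binder from ★ p850544's RAW [5β] through ★ (B-STD) (iii) -/

section RawCayleyClause

variable (L : Type) [Field L] [NumberField L] [IsCMField L] (α : Fin 3 → L)
  (S : Finset {w : InfinitePlace L // IsComplex w}) (w₀ : {w : InfinitePlace L // IsComplex w}) (p : {w : InfinitePlace L // IsComplex w} → Fin 3 → ℝ)
  (hw₀ : w₀ ∉ S) (hsp : w₀ ∈ splitChartPlaces L α) (hp : p w₀ 0 = p w₀ 2)
  -- (M-UNFOLD)'s block IS `U(σ_{w₀}(diag(α_{τ₀ 0}, α_{τ₀ 2})))` (★ p850446), `τ₀ = lineOf (formSign L α w₀)`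
  (K : Subgroup ↥(Subgroup.centralizer ({gprimeTorus L α S p} : Set ↥(arch (↥(maximalRealSubfield L)) L (IsCMField.complexConj L) 3 (Matrix.diagonal α)))))
  (e : ↥(Subgroup.centralizer ({gprimeTorus L α S p} : Set ↥(arch (↥(maximalRealSubfield L)) L (IsCMField.complexConj L) 3 (Matrix.diagonal α)))) ≃ₜ*
    ↥(unitaryGroupOfForm (starRingEnd ℂ) ((Matrix.diagonal ![α (lineOf (formSign L α w₀) 0), α (lineOf (formSign L α w₀) 2)]).map w₀.1.embedding)) × ↥K)
  -- ★ p850544 clause [5β], VERBATIM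
  (h5βraw : ∀ c : {w : InfinitePlace L // IsComplex w} → Fin 3 → ℝ,
    ((((e ⟨gprimeTorus L α (insert w₀ S) c, gprimeTorus_insert_mem_centralizer L α hw₀ hsp hp c⟩).1 :
        ↥(unitaryGroupOfForm (starRingEnd ℂ) ((Matrix.diagonal ![α (lineOf (formSign L α w₀) 0), α (lineOf (formSign L α w₀) 2)]).map w₀.1.embedding))) : GL (Fin 2) ℂ) :
          Matrix (Fin 2) (Fin 2) ℂ) =
      (boostStd (formRe L α w₀ ∘ lineOf (formSign L α w₀)) (c w₀)).submatrix ![0, 2] ![0, 2])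
  {J : Matrix (Fin 2) (Fin 2) ℂ} (hJ : J = (StdForm.antidiagonal 2).over ℂ)
  -- the covered wall at `w₀`: opposite real weights on the `(τ₀ 0, τ₀ 2)` plane
  (hsgn : (w₀.1.embedding (α (lineOf (formSign L α w₀) 0))).re * (w₀.1.embedding (α (lineOf (formSign L α w₀) 2))).re < 0)
  -- (B-STD) `φ` with its VALUE clause (★ p850476∕p850488 (ii)) and the standardised `e′`
  (φ : ↥(unitaryGroupOfForm (starRingEnd ℂ) ((Matrix.diagonal ![α (lineOf (formSign L α w₀) 0), α (lineOf (formSign L α w₀) 2)]).map w₀.1.embedding)) ≃ₜ*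
    ↥(unitaryGroupOfForm (starRingEnd ℂ) J))
  (hval : ∀ h : ↥(unitaryGroupOfForm (starRingEnd ℂ) ((Matrix.diagonal ![α (lineOf (formSign L α w₀) 0), α (lineOf (formSign L α w₀) 2)]).map w₀.1.embedding)),
    ((φ h : ↥(unitaryGroupOfForm (starRingEnd ℂ) J)) : GL (Fin 2) ℂ) =
      Matrix.GeneralLinearGroup.mkOfDetNeZero !![(1 : ℂ), 1; 1, -1] det_cayleyTwo_ne_zero *
        Matrix.GeneralLinearGroup.mkOfDetNeZero
          (Matrix.diagonal ![((Real.sqrt (|(w₀.1.embedding (![α (lineOf (formSign L α w₀) 0), α (lineOf (formSign L α w₀) 2)] 0)).re| / 2) : ℝ) : ℂ),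
            ((Real.sqrt (|(w₀.1.embedding (![α (lineOf (formSign L α w₀) 0), α (lineOf (formSign L α w₀) 2)] 1)).re| / 2) : ℝ) : ℂ)])
          (det_blockScale_ne_zero _ _ hsgn) * (h : GL (Fin 2) ℂ) *
      (Matrix.GeneralLinearGroup.mkOfDetNeZero !![(1 : ℂ), 1; 1, -1] det_cayleyTwo_ne_zero *
        Matrix.GeneralLinearGroup.mkOfDetNeZero
          (Matrix.diagonal ![((Real.sqrt (|(w₀.1.embedding (![α (lineOf (formSign L α w₀) 0), α (lineOf (formSign L α w₀) 2)] 0)).re| / 2) : ℝ) : ℂ),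
            ((Real.sqrt (|(w₀.1.embedding (![α (lineOf (formSign L α w₀) 0), α (lineOf (formSign L α w₀) 2)] 1)).re| / 2) : ℝ) : ℂ)])
          (det_blockScale_ne_zero _ _ hsgn))⁻¹)
  (e' : ↥(Subgroup.centralizer ({gprimeTorus L α S p} : Set ↥(arch (↥(maximalRealSubfield L)) L (IsCMField.complexConj L) 3 (Matrix.diagonal α)))) ≃ₜ*
    ↥(unitaryGroupOfForm (starRingEnd ℂ) J) × ↥K)
  (he' : ∀ g, e' g = (φ (e g).1, (e g).2))

include h5βraw hval he' in
/-- **THE `h5β` BINDER OF `setOf_fst_snd_mem_eq_chartBoxImgG_insert` ∕ `exists_hmap_hmapβ_descentConst_eq_of_clauses` FROM THE RAW CLAUSE**: ★ p850544 [5β] (the block of a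
Cayley-chart point is the `{0,2}`-minor of the relabelled boost) read through (B-STD)'s `φ` by ★ `std_eq_hypBlockGL_of_coe_eq_boost` (p850661): the `U(J)`-component of
`e′ γ♯_c` IS the split-torus element `hypBlockGL (c w₀ 0) (c w₀ 2)`. [cite: Rogawski1990, §3.6 p. 31; §8.2 p. 122] [cite: Knapp1986, Ch. V §3] -/
theorem fst_std_gprimeTorus_insert_eq_hypBlockGL (c : {w : InfinitePlace L // IsComplex w} → Fin 3 → ℝ) :
    (e' ⟨gprimeTorus L α (insert w₀ S) c, gprimeTorus_insert_mem_centralizer L α hw₀ hsp hp c⟩).1 =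
      ⟨hypBlockGL (c w₀ 0) (c w₀ 2), hypBlockGL_mem_of_eq_over hJ (c w₀ 0) (c w₀ 2)⟩ := by
  rw [he']
  exact std_eq_hypBlockGL_of_coe_eq_boost (w₀.1.embedding) ![α (lineOf (formSign L α w₀) 0), α (lineOf (formSign L α w₀) 2)] hJ hsgn φ hval
    (formRe L α w₀ ∘ lineOf (formSign L α w₀)) rfl rfl (c w₀) _ (h5βraw c)

end RawCayleyClause

end Literature.NumberTheory.Rogawski1990

end
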